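import Summits.QuantumFields.YangMills.Theorems.F4SubCurvatureDoorLaplaceFourierRegistered
import Mathlib
import HarnessLib

/-!
# S1 programme (⟨stmt-QuantumFields-23125⟩) — rung R-S1c `ConePinning` BY NAME

Crux `F4SubCurvatureDoor.RationalToGeneral` ⟨stmt-QuantumFields-23125⟩, owner file `Cruxes/RationalToGeneral/Lines/forward_cone_rungs.lean`
(ns `…Cruxes.RationalToGeneral.ForwardConeRungs`; the native 4-D plan for the XL stub S1 `ForwardConeSupport`).  This file restates R-S1c
`ConePinning` CHARACTER-IDENTICALLY and proves `conePinning_holds : ConePinning` — pure measure theory: a `t`-uniform bound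
`∫ e^{-t(E - κ|q⃗|)} dμ ≤ C` for all large `t` forces `μ{E < κ|q⃗|} = 0`, because on `{κ|q⃗| - E ≥ δ}` the integrand is `≥ e^{tδ}`, so
`μ{κ|q⃗| - E ≥ δ} ≤ C e^{-tδ} → 0`, and `{E < κ|q⃗|} = ⋃ₙ {κ|q⃗| - E ≥ 1/(n+1)}`.

HONEST LABEL: one rung (S–M) of the S1 programme; R-S1a/b/d, S1, ⟨23125⟩, ⟨23035⟩, R2d and the Yang–Mills mass gap remain OPEN; no summit is
proved by a line.
-/

noncomputable section

open MeasureTheory Filter Topology Set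
open scoped BigOperators ENNReal

namespace Summit.QuantumFields.YangMills.Theorems.F4SubCurvatureDoorConePinningRegistered

open Summit.QuantumFields.YangMills.Theorems.F4SubCurvatureDoorLaplaceFourierRegistered (E4 E3 InClass timeSpace IsLF)

/-- R-S1c «CONE PINNING» (S–M, pure measure theory): a `t`-uniform bound on `∫ e^{−t(E − κ|q⃗|)} dμ` for large `t` forces `E ≥ κ|q⃗|` a.e. -/
def ConePinning : Prop :=
  ∀ (μ : Measure (ℝ × E3)) (κ : ℝ), 0 < κ →
    (∃ C t₀ : ℝ, ∀ t : ℝ, t₀ ≤ t →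
        Integrable (fun p : ℝ × E3 => Real.exp (-(t * p.1) + κ * t * ‖p.2‖)) μ ∧
        ∫ p : ℝ × E3, Real.exp (-(t * p.1) + κ * t * ‖p.2‖) ∂μ ≤ C) →
    μ {p | p.1 < κ * ‖p.2‖} = 0

/-- The slab `{κ|q⃗| − E ≥ δ}` is null under a `t`-uniform exponential-moment bound. -/
theorem measure_slab_eq_zero (μ : Measure (ℝ × E3)) {κ C t₀ δ : ℝ} (hδ : 0 < δ)
    (h : ∀ t : ℝ, t₀ ≤ t → Integrable (fun p : ℝ × E3 => Real.exp (-(t * p.1) + κ * t * ‖p.2‖)) μ ∧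
        ∫ p : ℝ × E3, Real.exp (-(t * p.1) + κ * t * ‖p.2‖) ∂μ ≤ C) :
    μ {p : ℝ × E3 | δ ≤ κ * ‖p.2‖ - p.1} = 0 := by
  set S : Set (ℝ × E3) := {p | δ ≤ κ * ‖p.2‖ - p.1} with hS
  -- for every `t ≥ max t₀ 0`: `μ S · e^{tδ} ≤ C`
  have hkey : ∀ t : ℝ, t₀ ≤ t → 0 ≤ t → μ S ≤ ENNReal.ofReal (C * Real.exp (-(t * δ))) := by
    intro t ht ht0
    obtain ⟨hint, hle⟩ := h t ht
    have h1 : ENNReal.ofReal (Real.exp (t * δ)) * μ S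
        ≤ ∫⁻ p, ENNReal.ofReal (Real.exp (-(t * p.1) + κ * t * ‖p.2‖)) ∂μ := by
      calc ENNReal.ofReal (Real.exp (t * δ)) * μ S = ∫⁻ _ in S, ENNReal.ofReal (Real.exp (t * δ)) ∂μ := by
            rw [setLIntegral_const]
        _ ≤ ∫⁻ p in S, ENNReal.ofReal (Real.exp (-(t * p.1) + κ * t * ‖p.2‖)) ∂μ := by
            refine setLIntegral_mono' (measurableSet_le measurable_const (by fun_prop)) fun p hp => ?_
            refine ENNReal.ofReal_le_ofReal (Real.exp_le_exp.2 ?_)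
            have : δ ≤ κ * ‖p.2‖ - p.1 := hp
            nlinarith
        _ ≤ ∫⁻ p, ENNReal.ofReal (Real.exp (-(t * p.1) + κ * t * ‖p.2‖)) ∂μ := setLIntegral_le_lintegral _ _
    have h2 : ∫⁻ p, ENNReal.ofReal (Real.exp (-(t * p.1) + κ * t * ‖p.2‖)) ∂μ ≤ ENNReal.ofReal C := by
      rw [← ofReal_integral_eq_lintegral_ofReal hint (ae_of_all _ fun p => (Real.exp_pos _).le)]
      exact ENNReal.ofReal_le_ofReal hle
    have h3 := h1.trans h2
    have hpos : 0 < Real.exp (t * δ) := Real.exp_pos _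
    calc μ S = (ENNReal.ofReal (Real.exp (t * δ)))⁻¹ * (ENNReal.ofReal (Real.exp (t * δ)) * μ S) := by
          rw [← mul_assoc, ENNReal.inv_mul_cancel (by simpa using hpos) ENNReal.ofReal_ne_top, one_mul]
      _ ≤ (ENNReal.ofReal (Real.exp (t * δ)))⁻¹ * ENNReal.ofReal C := by gcongr
      _ = ENNReal.ofReal (C * Real.exp (-(t * δ))) := by
          rw [← ENNReal.ofReal_inv_of_pos hpos, ← ENNReal.ofReal_mul (inv_nonneg.2 hpos.le), Real.exp_neg]
          ring_nf
  -- let `t → ∞`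
  have htend : Tendsto (fun t : ℝ => ENNReal.ofReal (C * Real.exp (-(t * δ)))) atTop (𝓝 0) := by
    rw [← ENNReal.ofReal_zero]
    refine ENNReal.tendsto_ofReal ?_
    have h1 : Tendsto (fun t : ℝ => Real.exp (-(t * δ))) atTop (𝓝 0) := by
      have : Tendsto (fun t : ℝ => -(t * δ)) atTop atBot :=
        tendsto_neg_atTop_atBot.comp (tendsto_id.atTop_mul_const hδ)
      exact Real.tendsto_exp_atBot.comp this
    simpa using h1.const_mul C
  refine le_antisymm ?_ bot_le
  refine ge_of_tendsto htend ?_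
  rw [eventually_atTop]
  exact ⟨max t₀ 0, fun t ht => hkey t (le_trans (le_max_left _ _) ht) (le_trans (le_max_right _ _) ht)⟩

/-- **RUNG R-S1c (by name): `ConePinning`.** -/
theorem conePinning_holds : ConePinning := by
  intro μ κ hκ h
  obtain ⟨C, t₀, hCt⟩ := h
  have hslab : ∀ n : ℕ, μ {p : ℝ × E3 | (1 : ℝ) / (n + 1) ≤ κ * ‖p.2‖ - p.1} = 0 := fun n =>
    measure_slab_eq_zero μ (by positivity) hCt
  have hcov : {p : ℝ × E3 | p.1 < κ * ‖p.2‖} ⊆ ⋃ n : ℕ, {p : ℝ × E3 | (1 : ℝ) / (n + 1) ≤ κ * ‖p.2‖ - p.1} := by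
    intro p hp
    simp only [mem_setOf_eq] at hp
    obtain ⟨n, hn⟩ := exists_nat_one_div_lt (sub_pos.2 hp)
    exact mem_iUnion.2 ⟨n, le_of_lt hn⟩
  exact measure_mono_null hcov (measure_iUnion_null hslab)

end Summit.QuantumFields.YangMills.Theorems.F4SubCurvatureDoorConePinningRegistered

end
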